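import Summits.CriticalPhenomena.CardyFormulaZ2.Theorems.CardyBoundaryCoulombGasHalfPlaneMarkDensityLawNonDegeneracy
import Literature.Probability.Percolation.RSWProofs

/-!
# `HalfPlaneMarkDensityLaw` (crux stmt-CriticalPhenomena-5661), line `Sketch`, wave 2:
# stub `stub_primalArch` — a primal arch from the source arc over to the target window

For critical bond percolation on `ℤ²` and reals `a < b < x'' < y`, `h > 0`, with
`A = ⌊an⌋, B = ⌊bn⌋, X = ⌊x''n⌋, Y = ⌊yn⌋, H = ⌊hn⌋`, the source arc `[A,B]×{0}` is joined to the
window `[X,Y]×{0}` inside the arch-shaped tube `[A,B]×[0,3H] ∪ [A,Y]×[2H,3H] ∪ [X,Y]×[0,3H]` with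
probability `≥ c₁ > 0` eventually in `n`.

* DETERMINISTIC GLUING (`PrimalArch.arch_glue`, the pattern of `Subseq.glue_arcs`): an open top–bottom
  crossing of the left column `[A,B]×[0,3H]`, an open left–right crossing of the bar `[A,Y]×[2H,3H]`
  and an open top–bottom crossing of the right column `[X,Y]×[0,3H]` join the two arcs inside the
  tube: the bar crossing's initial segment up to its first visit to the column `B`
  (`exists_openConnIn_column`) is a left–right crossing of `[A,B]×[0,3H]`, hence meets the first
  vertical crossing (`exists_mem_support_of_crossing`); symmetrically its final segment after the
  last visit to the column `X` (`exists_openConnIn_column_ge`) meets the second one.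
* PROBABILITY (`PrimalArch.arch_prob`): Harris–FKG twice, translation invariance
  (`real_openCrossing_shift`), `real_tbCrossing` and the RSW lower bound (`rsw_lowerBound_holds`,
  `crossingProb_anti_left`) at aspect ratios fixed by the reals; floor arithmetic makes the three
  aspect conditions hold eventually in `n`.
-/

noncomputable section

namespace Summit.CriticalPhenomena.CardyFormulaZ2.Cruxes.HalfPlaneMarkDensityLaw.SketchLine

open Literature.Probability.Percolation Literature.Probability.LatticeModels
open MeasureTheory Filter Set SimpleGraph
open scoped Topology
open Summit.CriticalPhenomena.CardyFormulaZ2.Theorems.HalfPlaneMarkDensityLaw.Negative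

namespace Window

namespace PrimalArch

/-- The RSW input: for aspect `K ≥ 2`, `P[LR crossing of [0,m]×[0,s]] ≥ c_K` whenever
`m + 1 ≤ K(s+1)` (`rsw_lowerBound_holds` + monotonicity in the length). [folklore] -/
theorem exists_rsw_const (K : ℕ) (hK : 2 ≤ K) :
    ∃ cK : ℝ, 0 < cK ∧ ∀ m s : ℕ, m + 1 ≤ K * (s + 1) → cK ≤ crossingProb half m s := by
  obtain ⟨cK, hcK, hcross⟩ := rsw_lowerBound_holds K hK
  refine ⟨cK, hcK, fun m s hms ↦ ?_⟩
  have h1 := hcross (s + 1) (by omega)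
  rw [show s + 1 - 1 = s by omega] at h1
  exact h1.trans (crossingProb_anti_left half (by omega) s)

/-- **Deterministic gluing of the arch.** For a lattice configuration, an open top–bottom crossing of
the left column `[A,B]×[0,3H]`, an open left–right crossing of the bar `[A,Y]×[2H,3H]` and an open
top–bottom crossing of the right column `[X,Y]×[0,3H]` join `[A,B]×{0}` to `[X,Y]×{0}` inside the
arch-shaped tube. [folklore] -/
theorem arch_glue {A Bm X Y H : ℤ} {s₁ s₃ w Hn : ℕ} (hs₁ : (s₁ : ℤ) = Bm - A) (hs₃ : (s₃ : ℤ) = Y - X)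
    (hw : (w : ℤ) = Y - A) (hHn : (Hn : ℤ) = H) (hAX : A ≤ X) (hBY : Bm ≤ Y)
    {ω : BondConfig (Site 2)} (hω : ω ⊆ (zdGraph 2).edgeSet)
    (hV₁ : ω ∈ openCrossing ((· + (![A, 0] : Site 2)) '' (↑(rectangle s₁ (3 * Hn)) : Set (Site 2)))
      ((· + (![A, 0] : Site 2)) '' (↑(bottomSide s₁ (3 * Hn)) : Set (Site 2)))
      ((· + (![A, 0] : Site 2)) '' (↑(topSide s₁ (3 * Hn)) : Set (Site 2))))
    (hH : ω ∈ openCrossing ((· + (![A, 2 * H] : Site 2)) '' (↑(rectangle w Hn) : Set (Site 2)))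
      ((· + (![A, 2 * H] : Site 2)) '' (↑(leftSide w Hn) : Set (Site 2)))
      ((· + (![A, 2 * H] : Site 2)) '' (↑(rightSide w Hn) : Set (Site 2))))
    (hV₂ : ω ∈ openCrossing ((· + (![X, 0] : Site 2)) '' (↑(rectangle s₃ (3 * Hn)) : Set (Site 2)))
      ((· + (![X, 0] : Site 2)) '' (↑(bottomSide s₃ (3 * Hn)) : Set (Site 2)))
      ((· + (![X, 0] : Site 2)) '' (↑(topSide s₃ (3 * Hn)) : Set (Site 2)))) :
    ω ∈ openCrossing
      ({v : Site 2 | A ≤ v 0 ∧ v 0 ≤ Bm ∧ 0 ≤ v 1 ∧ v 1 ≤ 3 * H} ∪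
        {v : Site 2 | A ≤ v 0 ∧ v 0 ≤ Y ∧ 2 * H ≤ v 1 ∧ v 1 ≤ 3 * H} ∪
        {v : Site 2 | X ≤ v 0 ∧ v 0 ≤ Y ∧ 0 ≤ v 1 ∧ v 1 ≤ 3 * H})
      (rowIcc A Bm) (rowIcc X Y) := by
  classical
  set T : Set (Site 2) := {v : Site 2 | A ≤ v 0 ∧ v 0 ≤ Bm ∧ 0 ≤ v 1 ∧ v 1 ≤ 3 * H} ∪
    {v : Site 2 | A ≤ v 0 ∧ v 0 ≤ Y ∧ 2 * H ≤ v 1 ∧ v 1 ≤ 3 * H} ∪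
    {v : Site 2 | X ≤ v 0 ∧ v 0 ≤ Y ∧ 0 ≤ v 1 ∧ v 1 ≤ 3 * H} with hT
  -- the three boxes
  have hR₁ : ∀ z : Site 2, z ∈ (· + (![A, 0] : Site 2)) '' (↑(rectangle s₁ (3 * Hn)) : Set (Site 2)) ↔
      A ≤ z 0 ∧ z 0 ≤ Bm ∧ 0 ≤ z 1 ∧ z 1 ≤ 3 * H := by
    intro z
    rw [mem_image_add_rectangle]
    simp only [Matrix.cons_val_zero, Matrix.cons_val_one]
    push_cast
    constructor <;> intro h <;> omega
  have hR₂ : ∀ z : Site 2, z ∈ (· + (![A, 2 * H] : Site 2)) '' (↑(rectangle w Hn) : Set (Site 2)) ↔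
      A ≤ z 0 ∧ z 0 ≤ Y ∧ 2 * H ≤ z 1 ∧ z 1 ≤ 3 * H := by
    intro z
    rw [mem_image_add_rectangle]
    simp only [Matrix.cons_val_zero, Matrix.cons_val_one]
    constructor <;> intro h <;> omega
  have hR₃ : ∀ z : Site 2, z ∈ (· + (![X, 0] : Site 2)) '' (↑(rectangle s₃ (3 * Hn)) : Set (Site 2)) ↔
      X ≤ z 0 ∧ z 0 ≤ Y ∧ 0 ≤ z 1 ∧ z 1 ≤ 3 * H := by
    intro z
    rw [mem_image_add_rectangle]
    simp only [Matrix.cons_val_zero, Matrix.cons_val_one]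
    push_cast
    constructor <;> intro h <;> omega
  have hB₁T : (· + (![A, 0] : Site 2)) '' (↑(rectangle s₁ (3 * Hn)) : Set (Site 2)) ⊆ T := by
    intro z hz; rw [hR₁] at hz; rw [hT]; exact mem_union_left _ (mem_union_left _ hz)
  have hB₂T : (· + (![A, 2 * H] : Site 2)) '' (↑(rectangle w Hn) : Set (Site 2)) ⊆ T := by
    intro z hz; rw [hR₂] at hz; rw [hT]; exact mem_union_left _ (mem_union_right _ hz)
  have hB₃T : (· + (![X, 0] : Site 2)) '' (↑(rectangle s₃ (3 * Hn)) : Set (Site 2)) ⊆ T := by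
    intro z hz; rw [hR₃] at hz; rw [hT]; exact mem_union_right _ hz
  -- the horizontal crossing of the bar
  obtain ⟨l, hl, r, hr, hlr⟩ := hH
  rw [mem_image_add_leftSide] at hl
  rw [mem_image_add_rightSide] at hr
  simp only [Matrix.cons_val_zero, Matrix.cons_val_one] at hl hr
  -- its part before the first visit to the column `Bm`, inside the left column box
  obtain ⟨m₁, hm₁0, hlm₁⟩ := exists_openConnIn_column hω Bm (by omega) (by omega) hlr
  obtain ⟨P₁, hP₁S, hP₁ω⟩ := exists_walk_of_mem_openConnIn hω hlm₁
  have hP₁box : ∀ z ∈ P₁.support, A ≤ z 0 ∧ z 0 ≤ Bm ∧ (0 : ℤ) ≤ z 1 ∧ z 1 ≤ 3 * H := by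
    intro z hz
    have h := hP₁S z hz
    rw [mem_inter_iff, hR₂, mem_setOf_eq] at h
    omega
  -- the vertical crossing of the left column box
  obtain ⟨b₁, hb₁, t₁, ht₁, hbt₁⟩ := hV₁
  rw [mem_image_add_bottomSide] at hb₁
  rw [mem_image_add_topSide] at ht₁
  simp only [Matrix.cons_val_zero, Matrix.cons_val_one] at hb₁ ht₁
  push_cast at hb₁ ht₁
  obtain ⟨Q₁, hQ₁S, hQ₁ω⟩ := exists_walk_of_mem_openConnIn hω hbt₁
  have hQ₁box : ∀ z ∈ Q₁.support, A ≤ z 0 ∧ z 0 ≤ Bm ∧ (0 : ℤ) ≤ z 1 ∧ z 1 ≤ 3 * H :=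
    fun z hz ↦ (hR₁ z).1 (hQ₁S z hz)
  obtain ⟨w₁, hw₁P, hw₁Q⟩ := exists_mem_support_of_crossing (L := A) (R := Bm) (B := 0) (T := 3 * H)
    P₁ Q₁ hP₁box hQ₁box hl.2 hm₁0 hb₁.2 (by omega)
  -- the part of the horizontal crossing after its last visit to the column `X`
  have hrl : ω ∈ openConnIn ((· + (![A, 2 * H] : Site 2)) '' (↑(rectangle w Hn) : Set (Site 2))) r l := by
    rw [openConnIn_comm]; exact hlr
  obtain ⟨m₂, hm₂0, hrm₂⟩ := exists_openConnIn_column_ge hω X (by omega) (by omega) hrl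
  have hm₂r : ω ∈ openConnIn (((· + (![A, 2 * H] : Site 2)) '' (↑(rectangle w Hn) : Set (Site 2))) ∩
      {z | X ≤ z 0}) m₂ r := by
    rw [openConnIn_comm]; exact hrm₂
  obtain ⟨P₂, hP₂S, hP₂ω⟩ := exists_walk_of_mem_openConnIn hω hm₂r
  have hP₂box : ∀ z ∈ P₂.support, X ≤ z 0 ∧ z 0 ≤ Y ∧ (0 : ℤ) ≤ z 1 ∧ z 1 ≤ 3 * H := by
    intro z hz
    have h := hP₂S z hz
    rw [mem_inter_iff, hR₂, mem_setOf_eq] at h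
    omega
  -- the vertical crossing of the right column box
  obtain ⟨b₂, hb₂, t₂, ht₂, hbt₂⟩ := hV₂
  rw [mem_image_add_bottomSide] at hb₂
  rw [mem_image_add_topSide] at ht₂
  simp only [Matrix.cons_val_zero, Matrix.cons_val_one] at hb₂ ht₂
  push_cast at hb₂ ht₂
  obtain ⟨Q₂, hQ₂S, hQ₂ω⟩ := exists_walk_of_mem_openConnIn hω hbt₂
  have hQ₂box : ∀ z ∈ Q₂.support, X ≤ z 0 ∧ z 0 ≤ Y ∧ (0 : ℤ) ≤ z 1 ∧ z 1 ≤ 3 * H :=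
    fun z hz ↦ (hR₃ z).1 (hQ₂S z hz)
  obtain ⟨w₂, hw₂P, hw₂Q⟩ := exists_mem_support_of_crossing (L := X) (R := Y) (B := 0) (T := 3 * H)
    P₂ Q₂ hP₂box hQ₂box hm₂0 (by omega) hb₂.2 (by omega)
  -- assemble `b₁ ↔ w₁ ↔ l ↔ r ↔ m₂ ↔ w₂ ↔ b₂` inside the tube
  have c₁ : ω ∈ openConnIn T b₁ w₁ :=
    openConnIn_mono hB₁T _ _ (mem_openConnIn_of_mem_support Q₁ hQ₁S hQ₁ω hw₁Q)
  have c₂ : ω ∈ openConnIn T w₁ l := by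
    rw [openConnIn_comm]
    exact openConnIn_mono (inter_subset_left.trans hB₂T) _ _
      (mem_openConnIn_of_mem_support P₁ hP₁S hP₁ω hw₁P)
  have c₃ : ω ∈ openConnIn T l r := openConnIn_mono hB₂T _ _ hlr
  have c₄ : ω ∈ openConnIn T r m₂ := openConnIn_mono (inter_subset_left.trans hB₂T) _ _ hrm₂
  have c₅ : ω ∈ openConnIn T m₂ w₂ :=
    openConnIn_mono (inter_subset_left.trans hB₂T) _ _
      (mem_openConnIn_of_mem_support P₂ hP₂S hP₂ω hw₂P)
  have c₆ : ω ∈ openConnIn T w₂ b₂ := by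
    rw [openConnIn_comm]
    exact openConnIn_mono hB₃T _ _ (mem_openConnIn_of_mem_support Q₂ hQ₂S hQ₂ω hw₂Q)
  refine ⟨b₁, ⟨hb₁.2, hb₁.1.1, by omega⟩, b₂, ⟨hb₂.2, hb₂.1.1, by omega⟩, ?_⟩
  exact PlanarDuality.openConnIn_trans (PlanarDuality.openConnIn_trans
    (PlanarDuality.openConnIn_trans (PlanarDuality.openConnIn_trans
      (PlanarDuality.openConnIn_trans c₁ c₂) c₃) c₄) c₅) c₆

/-- **Lattice lower bound for the arch** (Harris–FKG twice, translation invariance, RSW at aspect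
`K`): if the three boxes have aspect conditions `3H + 1 ≤ K(B − A + 1)`, `Y − A + 1 ≤ K(H + 1)`,
`3H + 1 ≤ K(Y − X + 1)`, the arch event has probability `≥ c_K³`. [folklore] -/
theorem arch_prob {K : ℕ} {cK : ℝ} (hcK0 : 0 ≤ cK)
    (hRSW : ∀ m s : ℕ, m + 1 ≤ K * (s + 1) → cK ≤ crossingProb half m s)
    {A Bm X Y H : ℤ} (hAB : A ≤ Bm) (hXY : X ≤ Y) (hAX : A ≤ X) (hBY : Bm ≤ Y) (hH0 : 0 ≤ H)
    (h1 : 3 * H + 1 ≤ K * (Bm - A + 1)) (h2 : Y - A + 1 ≤ K * (H + 1))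
    (h3 : 3 * H + 1 ≤ K * (Y - X + 1)) :
    cK ^ 3 ≤ μ.real (openCrossing
      ({v : Site 2 | A ≤ v 0 ∧ v 0 ≤ Bm ∧ 0 ≤ v 1 ∧ v 1 ≤ 3 * H} ∪
        {v : Site 2 | A ≤ v 0 ∧ v 0 ≤ Y ∧ 2 * H ≤ v 1 ∧ v 1 ≤ 3 * H} ∪
        {v : Site 2 | X ≤ v 0 ∧ v 0 ≤ Y ∧ 0 ≤ v 1 ∧ v 1 ≤ 3 * H})
      (rowIcc A Bm) (rowIcc X Y)) := by
  -- lattice side lengths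
  obtain ⟨s₁, hs₁⟩ : ∃ s₁ : ℕ, (s₁ : ℤ) = Bm - A := ⟨(Bm - A).toNat, Int.toNat_of_nonneg (by omega)⟩
  obtain ⟨s₃, hs₃⟩ : ∃ s₃ : ℕ, (s₃ : ℤ) = Y - X := ⟨(Y - X).toNat, Int.toNat_of_nonneg (by omega)⟩
  obtain ⟨w, hw⟩ : ∃ w : ℕ, (w : ℤ) = Y - A := ⟨(Y - A).toNat, Int.toNat_of_nonneg (by omega)⟩
  obtain ⟨Hn, hHn⟩ : ∃ Hn : ℕ, (Hn : ℤ) = H := ⟨H.toNat, Int.toNat_of_nonneg hH0⟩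
  have h1' : 3 * Hn + 1 ≤ K * (s₁ + 1) := by
    have : ((3 * Hn + 1 : ℕ) : ℤ) ≤ ((K * (s₁ + 1) : ℕ) : ℤ) := by push_cast; rw [hs₁, hHn]; exact h1
    exact_mod_cast this
  have h2' : w + 1 ≤ K * (Hn + 1) := by
    have : ((w + 1 : ℕ) : ℤ) ≤ ((K * (Hn + 1) : ℕ) : ℤ) := by push_cast; rw [hw, hHn]; exact h2
    exact_mod_cast this
  have h3' : 3 * Hn + 1 ≤ K * (s₃ + 1) := by
    have : ((3 * Hn + 1 : ℕ) : ℤ) ≤ ((K * (s₃ + 1) : ℕ) : ℤ) := by push_cast; rw [hs₃, hHn]; exact h3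
    exact_mod_cast this
  -- the three increasing events
  set V₁ := openCrossing ((· + (![A, 0] : Site 2)) '' (↑(rectangle s₁ (3 * Hn)) : Set (Site 2)))
      ((· + (![A, 0] : Site 2)) '' (↑(bottomSide s₁ (3 * Hn)) : Set (Site 2)))
      ((· + (![A, 0] : Site 2)) '' (↑(topSide s₁ (3 * Hn)) : Set (Site 2))) with hV₁def
  set Hb := openCrossing ((· + (![A, 2 * H] : Site 2)) '' (↑(rectangle w Hn) : Set (Site 2)))
      ((· + (![A, 2 * H] : Site 2)) '' (↑(leftSide w Hn) : Set (Site 2)))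
      ((· + (![A, 2 * H] : Site 2)) '' (↑(rightSide w Hn) : Set (Site 2))) with hHbdef
  set V₂ := openCrossing ((· + (![X, 0] : Site 2)) '' (↑(rectangle s₃ (3 * Hn)) : Set (Site 2)))
      ((· + (![X, 0] : Site 2)) '' (↑(bottomSide s₃ (3 * Hn)) : Set (Site 2)))
      ((· + (![X, 0] : Site 2)) '' (↑(topSide s₃ (3 * Hn)) : Set (Site 2))) with hV₂def
  have hV₁ : cK ≤ μ.real V₁ := by
    rw [hV₁def]
    unfold μ
    rw [real_openCrossing_shift]
    exact (hRSW _ _ h1').trans_eq (real_tbCrossing half (3 * Hn) s₁).symm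
  have hHb : cK ≤ μ.real Hb := by
    rw [hHbdef]
    unfold μ
    rw [real_openCrossing_shift]
    exact hRSW _ _ h2'
  have hV₂ : cK ≤ μ.real V₂ := by
    rw [hV₂def]
    unfold μ
    rw [real_openCrossing_shift]
    exact (hRSW _ _ h3').trans_eq (real_tbCrossing half (3 * Hn) s₃).symm
  have hupV₁ : IsUpperSet V₁ := isUpperSet_openCrossing _ _ _
  have hupH : IsUpperSet Hb := isUpperSet_openCrossing _ _ _
  have hupV₂ : IsUpperSet V₂ := isUpperSet_openCrossing _ _ _
  have hmV₁ : MeasurableSet V₁ := measurableSet_openCrossing_of_countable _ _ _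
  have hmH : MeasurableSet Hb := measurableSet_openCrossing_of_countable _ _ _
  have hmV₂ : MeasurableSet V₂ := measurableSet_openCrossing_of_countable _ _ _
  have hfkg1 : μ.real V₁ * μ.real Hb ≤ μ.real (V₁ ∩ Hb) :=
    harris_fkg_holds (zdGraph 2) half hupV₁ hupH hmV₁ hmH
  have hfkg2 : μ.real (V₁ ∩ Hb) * μ.real V₂ ≤ μ.real (V₁ ∩ Hb ∩ V₂) :=
    harris_fkg_holds (zdGraph 2) half (hupV₁.inter hupH) hupV₂ (hmV₁.inter hmH) hmV₂
  have hincl : μ.real (V₁ ∩ Hb ∩ V₂) ≤ μ.real (openCrossing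
      ({v : Site 2 | A ≤ v 0 ∧ v 0 ≤ Bm ∧ 0 ≤ v 1 ∧ v 1 ≤ 3 * H} ∪
        {v : Site 2 | A ≤ v 0 ∧ v 0 ≤ Y ∧ 2 * H ≤ v 1 ∧ v 1 ≤ 3 * H} ∪
        {v : Site 2 | X ≤ v 0 ∧ v 0 ≤ Y ∧ 0 ≤ v 1 ∧ v 1 ≤ 3 * H})
      (rowIcc A Bm) (rowIcc X Y)) := by
    rw [measureReal_def, measureReal_def]
    refine ENNReal.toReal_mono (measure_ne_top _ _) (measure_mono_ae ?_)
    filter_upwards [ae_subset_edgeSet (zdGraph 2) half] with ω hω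
    rintro ⟨⟨hv₁, hhb⟩, hv₂⟩
    exact arch_glue hs₁ hs₃ hw hHn hAX hBY hω hv₁ hhb hv₂
  have hcV₁ : 0 ≤ μ.real V₁ := measureReal_nonneg
  have hcH : 0 ≤ μ.real Hb := measureReal_nonneg
  calc cK ^ 3 = cK * cK * cK := by ring
    _ ≤ μ.real V₁ * μ.real Hb * μ.real V₂ :=
        mul_le_mul (mul_le_mul hV₁ hHb hcK0 hcV₁) hV₂ hcK0 (mul_nonneg hcV₁ hcH)
    _ ≤ μ.real (V₁ ∩ Hb) * μ.real V₂ := mul_le_mul_of_nonneg_right hfkg1 measureReal_nonneg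
    _ ≤ μ.real (V₁ ∩ Hb ∩ V₂) := hfkg2
    _ ≤ _ := hincl

end PrimalArch

/-- STUB W4 (primal arch): with probability `≥ c₁ > 0` eventually, the source arc `A_n` is joined to the
boundary window `[⌊x''n⌋, ⌊yn⌋]` inside the arch-shaped tube (left column over `A_n` up to height `3H`,
bar at heights `[2H, 3H]`, right column over the window), `H = ⌊hn⌋`. [folklore] -/
theorem stub_primalArch :
    ∀ (a b x'' y h : ℝ), a < b → b < x'' → x'' < y → 0 < h →
      ∃ c₁ : ℝ, 0 < c₁ ∧ ∀ᶠ n : ℕ in atTop,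
        c₁ ≤ μ.real (openCrossing
          ({v : Site 2 | ⌊a * n⌋ ≤ v 0 ∧ v 0 ≤ ⌊b * n⌋ ∧ 0 ≤ v 1 ∧ v 1 ≤ 3 * ⌊h * n⌋} ∪
           {v : Site 2 | ⌊a * n⌋ ≤ v 0 ∧ v 0 ≤ ⌊y * n⌋ ∧ 2 * ⌊h * n⌋ ≤ v 1 ∧ v 1 ≤ 3 * ⌊h * n⌋} ∪
           {v : Site 2 | ⌊x'' * n⌋ ≤ v 0 ∧ v 0 ≤ ⌊y * n⌋ ∧ 0 ≤ v 1 ∧ v 1 ≤ 3 * ⌊h * n⌋})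
          (arcA a b n) (rowIcc ⌊x'' * n⌋ ⌊y * n⌋)) := by
  intro a b x'' y h hab hbx hxy hh
  have hba : 0 < b - a := by linarith
  have hyx : 0 < y - x'' := by linarith
  have hya : 0 < y - a := by linarith
  set K : ℕ := ⌈3 * h / (b - a)⌉₊ + ⌈(y - a) / h⌉₊ + ⌈3 * h / (y - x'')⌉₊ + 2 with hK
  obtain ⟨cK, hcK, hRSW⟩ := PrimalArch.exists_rsw_const K (by omega)
  refine ⟨cK ^ 3, by positivity, ?_⟩
  have hK0 : (0 : ℝ) ≤ K := Nat.cast_nonneg K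
  have hc₁ : (0 : ℝ) ≤ ⌈3 * h / (b - a)⌉₊ := Nat.cast_nonneg _
  have hc₂ : (0 : ℝ) ≤ ⌈(y - a) / h⌉₊ := Nat.cast_nonneg _
  have hc₃ : (0 : ℝ) ≤ ⌈3 * h / (y - x'')⌉₊ := Nat.cast_nonneg _
  have hKr : (K : ℝ) = ⌈3 * h / (b - a)⌉₊ + ⌈(y - a) / h⌉₊ + ⌈3 * h / (y - x'')⌉₊ + 2 := by
    rw [hK]; push_cast; ring
  have hK₁ : 3 * h / (b - a) + 1 ≤ K := by rw [hKr]; linarith [Nat.le_ceil (3 * h / (b - a))]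
  have hK₂ : (y - a) / h + 1 ≤ K := by rw [hKr]; linarith [Nat.le_ceil ((y - a) / h)]
  have hK₃ : 3 * h / (y - x'') + 1 ≤ K := by rw [hKr]; linarith [Nat.le_ceil (3 * h / (y - x''))]
  filter_upwards [(tendsto_natCast_atTop_atTop.const_mul_atTop hba).eventually_ge_atTop 1,
    (tendsto_natCast_atTop_atTop.const_mul_atTop hyx).eventually_ge_atTop 1,
    (tendsto_natCast_atTop_atTop.const_mul_atTop hh).eventually_ge_atTop 2] with n hn₁ hn₂ hn₃
  have hn0 : (0 : ℝ) ≤ n := Nat.cast_nonneg n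
  -- floors
  have ha1 : (⌊a * (n : ℝ)⌋ : ℝ) ≤ a * n := Int.floor_le _
  have ha2 : a * (n : ℝ) < ⌊a * (n : ℝ)⌋ + 1 := Int.lt_floor_add_one _
  have hb2 : b * (n : ℝ) < ⌊b * (n : ℝ)⌋ + 1 := Int.lt_floor_add_one _
  have hx1 : (⌊x'' * (n : ℝ)⌋ : ℝ) ≤ x'' * n := Int.floor_le _
  have hy1 : (⌊y * (n : ℝ)⌋ : ℝ) ≤ y * n := Int.floor_le _
  have hy2 : y * (n : ℝ) < ⌊y * (n : ℝ)⌋ + 1 := Int.lt_floor_add_one _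
  have hh1 : (⌊h * (n : ℝ)⌋ : ℝ) ≤ h * n := Int.floor_le _
  have hh2 : h * (n : ℝ) < ⌊h * (n : ℝ)⌋ + 1 := Int.lt_floor_add_one _
  have hAB : ⌊a * (n : ℝ)⌋ ≤ ⌊b * (n : ℝ)⌋ := Int.floor_le_floor (by nlinarith)
  have hXY : ⌊x'' * (n : ℝ)⌋ ≤ ⌊y * (n : ℝ)⌋ := Int.floor_le_floor (by nlinarith)
  have hAX : ⌊a * (n : ℝ)⌋ ≤ ⌊x'' * (n : ℝ)⌋ := Int.floor_le_floor (by nlinarith)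
  have hBY : ⌊b * (n : ℝ)⌋ ≤ ⌊y * (n : ℝ)⌋ := Int.floor_le_floor (by nlinarith)
  have hH0 : 0 ≤ ⌊h * (n : ℝ)⌋ := Int.floor_nonneg.2 (by positivity)
  -- the three aspect conditions
  have h1 : 3 * ⌊h * (n : ℝ)⌋ + 1 ≤ (K : ℤ) * (⌊b * (n : ℝ)⌋ - ⌊a * (n : ℝ)⌋ + 1) := by
    have key : 3 * (⌊h * (n : ℝ)⌋ : ℝ) + 1 ≤ (K : ℝ) * ((⌊b * (n : ℝ)⌋ : ℝ) - ⌊a * (n : ℝ)⌋ + 1) := by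
      have i1 := mul_le_mul_of_nonneg_right hK₁ (by positivity : (0 : ℝ) ≤ (b - a) * n)
      have i2 : (K : ℝ) * ((b - a) * n) ≤ K * ((⌊b * (n : ℝ)⌋ : ℝ) - ⌊a * (n : ℝ)⌋ + 1) :=
        mul_le_mul_of_nonneg_left (by linarith) hK0
      have i3 : (3 * h / (b - a) + 1) * ((b - a) * n) = 3 * (h * n) + (b - a) * n := by
        field_simp
      linarith
    have key' : ((3 * ⌊h * (n : ℝ)⌋ + 1 : ℤ) : ℝ) ≤ ((K * (⌊b * (n : ℝ)⌋ - ⌊a * (n : ℝ)⌋ + 1) : ℤ) : ℝ) := by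
      push_cast; exact key
    exact Int.cast_le.1 key'
  have h2 : ⌊y * (n : ℝ)⌋ - ⌊a * (n : ℝ)⌋ + 1 ≤ (K : ℤ) * (⌊h * (n : ℝ)⌋ + 1) := by
    have key : (⌊y * (n : ℝ)⌋ : ℝ) - ⌊a * (n : ℝ)⌋ + 1 < (K : ℝ) * ((⌊h * (n : ℝ)⌋ : ℝ) + 1) := by
      have i1 := mul_le_mul_of_nonneg_right hK₂ (by positivity : (0 : ℝ) ≤ h * n)
      have i2 : (K : ℝ) * (h * n) ≤ K * ((⌊h * (n : ℝ)⌋ : ℝ) + 1) :=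
        mul_le_mul_of_nonneg_left hh2.le hK0
      have i3 : ((y - a) / h + 1) * (h * n) = (y - a) * n + h * n := by
        field_simp
      linarith
    have key' : ((⌊y * (n : ℝ)⌋ - ⌊a * (n : ℝ)⌋ + 1 : ℤ) : ℝ) < ((K * (⌊h * (n : ℝ)⌋ + 1) : ℤ) : ℝ) := by
      push_cast; exact key
    exact (Int.cast_lt.1 key').le
  have h3 : 3 * ⌊h * (n : ℝ)⌋ + 1 ≤ (K : ℤ) * (⌊y * (n : ℝ)⌋ - ⌊x'' * (n : ℝ)⌋ + 1) := by
    have key : 3 * (⌊h * (n : ℝ)⌋ : ℝ) + 1 ≤ (K : ℝ) * ((⌊y * (n : ℝ)⌋ : ℝ) - ⌊x'' * (n : ℝ)⌋ + 1) := by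
      have i1 := mul_le_mul_of_nonneg_right hK₃ (by positivity : (0 : ℝ) ≤ (y - x'') * n)
      have i2 : (K : ℝ) * ((y - x'') * n) ≤ K * ((⌊y * (n : ℝ)⌋ : ℝ) - ⌊x'' * (n : ℝ)⌋ + 1) :=
        mul_le_mul_of_nonneg_left (by linarith) hK0
      have i3 : (3 * h / (y - x'') + 1) * ((y - x'') * n) = 3 * (h * n) + (y - x'') * n := by
        field_simp
      linarith
    have key' : ((3 * ⌊h * (n : ℝ)⌋ + 1 : ℤ) : ℝ) ≤ ((K * (⌊y * (n : ℝ)⌋ - ⌊x'' * (n : ℝ)⌋ + 1) : ℤ) : ℝ) := by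
      push_cast; exact key
    exact Int.cast_le.1 key'
  exact PrimalArch.arch_prob hcK.le hRSW hAB hXY hAX hBY hH0 h1 h2 h3

end Window

end Summit.CriticalPhenomena.CardyFormulaZ2.Cruxes.HalfPlaneMarkDensityLaw.SketchLine

end
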